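import Summits.QuantumFields.YangMills.Theorems.AllWindowsColdBoxBoxHighLineWickPairCubicChart

/-!
# `ConnectedThreePoint`, QUARTIC vertices (U5-BLOCKERS §2, lift L2 / ASSEMBLY-U5 §3): two centred pairs of coordinates against a quartic monomial —
# the 72 CONNECTED pairings (24 «X» diagrams + 48 «tadpole» diagrams), process level and in the chart

Width seat `ym-line-sfw-p2-w3` (g41), cell ym-idea-1; U5 prep, helper-grade.  The even×even part of `f′(0) = κ₃,₀(c₀, c_T; U)` has, besides the QUADRATIC vertices
(✓`…Cum3TriangleBound`/✓`…GhostHaar`), the QUARTIC vertices `W₄` (Wilson quartic Taylor part), `Φ⁴` (`phiQuartic`), Haar⁴ — sums of quartic MONOMIALS.  For the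
Gaussian parts `linCurvSq` of the two plaquette costs (centred pairs `v_av_{a'} − S_{aa'}`, `v_bv_{b'} − S_{bb'}` weighted by `Λ₀⊗Λ₀`, `Λ_T⊗Λ_T`) the needed
Gaussian value is the CONNECTED part `E[:X_aX_{a'}: :X_bX_{b'}: ·N] − E[:X_aX_{a'}::X_bX_{b'}:]·E[N]`, `N = X_{n₀}X_{n₁}X_{n₂}X_{n₃}`:

* ★★ `WickPairCubic.integral_wick2_wick2_mul_four_connected` (process level, ANY legs — no trace condition needed):
  `∫ (X_aX_{a'} − C_{aa'})(X_bX_{b'} − C_{bb'})·N − (C_{ab}C_{a'b'} + C_{ab'}C_{a'b})·∫ N = Σ over the 72 pairings of the eight legs with no line inside a pair and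
  the vertex connected to the pairs` (24 «X»: each pair leg into the vertex; 48 «tadpole»: one pair–pair line, one leg of each pair into the vertex, one self-line
  at the vertex); from ✓`integral_wick2_mul_six` + ✓`integral_prod_six` + ✓`integral_prod_four` by `ring`;
* ★★ `gauss_wick2_wick2_mul_four_connected` — the same under `E₀ = (∫ · e^{−βvᵀPv})/(∫ e^{−βvᵀPv})` on a finite index type, `S = (2β)⁻¹P⁻¹`
  (generic transfer ✓`GaussianChartWick.integral_mul_exp_quadForm_eq_integral_legs`).
LEAD g78's announced general two-pair engine `integral_wick2_wick2_mul_prod` (|s| arbitrary) SUPERSEDES the first lemma when it lands; this file is the closed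
|s| = 4 instance the L2 quartic-vertex bound consumes now.  Summing the pairs against `Λ₀⊗Λ₀`, `Λ_T⊗Λ_T` (✓`ColourDiag.sum_rankOne_mul_mul`): «X» terms =
`D⁰(n_i,n_j)·D^T(n_k,n_l)` (four gradient lines), «tadpole» terms = `K(0,T)`-type chain × two gradient lines × `S(n_k,n_l)`; cold-box sizes `(1+T)⁻⁶·polylog` resp.
`(1+T)⁻⁴(1+d)⁻²(1+d)⁻²·polylog` — RELATIVE `≲ H⁴·polylog/β`; that bookkeeping (pattern of ✓`…WickPairCubicForm/ColdBox`) is NOT in this file.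

Tree + Mathlib only; no definitions; standard axioms.  HONEST LABEL: a tool for the RECORDED lift L2 of the NEXT rung U5 (⟨stmt-QuantumFields-24336⟩, UNSTAFFED);
⟨24004⟩ ⟨24336⟩ remain OPEN; route AllWindowsColdBox is DRAFT; no crux, rung or summit is proved; **the Yang–Mills mass gap is NOT proved by this file; no summit
is proved by a line.**
-/

set_option autoImplicit false

noncomputable section

open MeasureTheory ProbabilityTheory Matrix Finset
open Literature.Probability.Distributions.GaussianWick
open Summit.QuantumFields.YangMills.Theorems.AllWindowsColdBox.CubicChaos (integrable_mul_six integral_mul_four integral_prod_six)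

namespace Summit.QuantumFields.YangMills.Theorems.AllWindowsColdBoxBoxHighLine

namespace WickPairCubic

variable {T Ω : Type*} {mΩ : MeasurableSpace Ω} {P : Measure Ω} {X : T → Ω → ℝ}

/-- ★★ **Two centred pairs against a quartic monomial, connected part** (process level): the 72 connected pairings. -/
theorem integral_wick2_wick2_mul_four_connected (hX : IsGaussianProcess X P) (h0 : ∀ s, ∫ ω, X s ω ∂P = 0) (C : T → T → ℝ)
    (hC : ∀ s s', C s s' = ∫ ω, X s ω * X s' ω ∂P) (a a' b b' n₀ n₁ n₂ n₃ : T) :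
    (∫ ω, (X a ω * X a' ω - C a a') * (X b ω * X b' ω - C b b') * (X n₀ ω * X n₁ ω * X n₂ ω * X n₃ ω) ∂P) -
        (C a b * C a' b' + C a b' * C a' b) * ∫ ω, X n₀ ω * X n₁ ω * X n₂ ω * X n₃ ω ∂P =
      C a b * C a' n₀ * C b' n₁ * C n₂ n₃ +
        C a b * C a' n₀ * C b' n₂ * C n₁ n₃ +
        C a b * C a' n₀ * C b' n₃ * C n₁ n₂ +
        C a b * C a' n₁ * C b' n₀ * C n₂ n₃ +
        C a b * C a' n₁ * C b' n₂ * C n₀ n₃ +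
        C a b * C a' n₁ * C b' n₃ * C n₀ n₂ +
        C a b * C a' n₂ * C b' n₀ * C n₁ n₃ +
        C a b * C a' n₂ * C b' n₁ * C n₀ n₃ +
        C a b * C a' n₂ * C b' n₃ * C n₀ n₁ +
        C a b * C a' n₃ * C b' n₀ * C n₁ n₂ +
        C a b * C a' n₃ * C b' n₁ * C n₀ n₂ +
        C a b * C a' n₃ * C b' n₂ * C n₀ n₁ +
        C a b' * C a' n₀ * C b n₁ * C n₂ n₃ +
        C a b' * C a' n₀ * C b n₂ * C n₁ n₃ +
        C a b' * C a' n₀ * C b n₃ * C n₁ n₂ +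
        C a b' * C a' n₁ * C b n₀ * C n₂ n₃ +
        C a b' * C a' n₁ * C b n₂ * C n₀ n₃ +
        C a b' * C a' n₁ * C b n₃ * C n₀ n₂ +
        C a b' * C a' n₂ * C b n₀ * C n₁ n₃ +
        C a b' * C a' n₂ * C b n₁ * C n₀ n₃ +
        C a b' * C a' n₂ * C b n₃ * C n₀ n₁ +
        C a b' * C a' n₃ * C b n₀ * C n₁ n₂ +
        C a b' * C a' n₃ * C b n₁ * C n₀ n₂ +
        C a b' * C a' n₃ * C b n₂ * C n₀ n₁ +
        C a n₀ * C a' b * C b' n₁ * C n₂ n₃ +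
        C a n₀ * C a' b * C b' n₂ * C n₁ n₃ +
        C a n₀ * C a' b * C b' n₃ * C n₁ n₂ +
        C a n₀ * C a' b' * C b n₁ * C n₂ n₃ +
        C a n₀ * C a' b' * C b n₂ * C n₁ n₃ +
        C a n₀ * C a' b' * C b n₃ * C n₁ n₂ +
        C a n₀ * C a' n₁ * C b n₂ * C b' n₃ +
        C a n₀ * C a' n₁ * C b n₃ * C b' n₂ +
        C a n₀ * C a' n₂ * C b n₁ * C b' n₃ +
        C a n₀ * C a' n₂ * C b n₃ * C b' n₁ +
        C a n₀ * C a' n₃ * C b n₁ * C b' n₂ +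
        C a n₀ * C a' n₃ * C b n₂ * C b' n₁ +
        C a n₁ * C a' b * C b' n₀ * C n₂ n₃ +
        C a n₁ * C a' b * C b' n₂ * C n₀ n₃ +
        C a n₁ * C a' b * C b' n₃ * C n₀ n₂ +
        C a n₁ * C a' b' * C b n₀ * C n₂ n₃ +
        C a n₁ * C a' b' * C b n₂ * C n₀ n₃ +
        C a n₁ * C a' b' * C b n₃ * C n₀ n₂ +
        C a n₁ * C a' n₀ * C b n₂ * C b' n₃ +
        C a n₁ * C a' n₀ * C b n₃ * C b' n₂ +
        C a n₁ * C a' n₂ * C b n₀ * C b' n₃ +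
        C a n₁ * C a' n₂ * C b n₃ * C b' n₀ +
        C a n₁ * C a' n₃ * C b n₀ * C b' n₂ +
        C a n₁ * C a' n₃ * C b n₂ * C b' n₀ +
        C a n₂ * C a' b * C b' n₀ * C n₁ n₃ +
        C a n₂ * C a' b * C b' n₁ * C n₀ n₃ +
        C a n₂ * C a' b * C b' n₃ * C n₀ n₁ +
        C a n₂ * C a' b' * C b n₀ * C n₁ n₃ +
        C a n₂ * C a' b' * C b n₁ * C n₀ n₃ +
        C a n₂ * C a' b' * C b n₃ * C n₀ n₁ +
        C a n₂ * C a' n₀ * C b n₁ * C b' n₃ +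
        C a n₂ * C a' n₀ * C b n₃ * C b' n₁ +
        C a n₂ * C a' n₁ * C b n₀ * C b' n₃ +
        C a n₂ * C a' n₁ * C b n₃ * C b' n₀ +
        C a n₂ * C a' n₃ * C b n₀ * C b' n₁ +
        C a n₂ * C a' n₃ * C b n₁ * C b' n₀ +
        C a n₃ * C a' b * C b' n₀ * C n₁ n₂ +
        C a n₃ * C a' b * C b' n₁ * C n₀ n₂ +
        C a n₃ * C a' b * C b' n₂ * C n₀ n₁ +
        C a n₃ * C a' b' * C b n₀ * C n₁ n₂ +
        C a n₃ * C a' b' * C b n₁ * C n₀ n₂ +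
        C a n₃ * C a' b' * C b n₂ * C n₀ n₁ +
        C a n₃ * C a' n₀ * C b n₁ * C b' n₂ +
        C a n₃ * C a' n₀ * C b n₂ * C b' n₁ +
        C a n₃ * C a' n₁ * C b n₀ * C b' n₂ +
        C a n₃ * C a' n₁ * C b n₂ * C b' n₀ +
        C a n₃ * C a' n₂ * C b n₀ * C b' n₁ +
        C a n₃ * C a' n₂ * C b n₁ * C b' n₀ := by
  have hre : ∀ ω, (X a ω * X a' ω - C a a') * (X b ω * X b' ω - C b b') * (X n₀ ω * X n₁ ω * X n₂ ω * X n₃ ω) =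
      (X a ω * X a' ω - ∫ ω', X a ω' * X a' ω' ∂P) * (X b ω * X b' ω * X n₀ ω * X n₁ ω * X n₂ ω * X n₃ ω) -
        C b b' * (X a ω * X a' ω * X n₀ ω * X n₁ ω * X n₂ ω * X n₃ ω) +
        C b b' * C a a' * (X n₀ ω * X n₁ ω * X n₂ ω * X n₃ ω) := fun ω => by
    rw [hC a a']; ring
  simp_rw [hre]
  have i1 : Integrable (fun ω => (X a ω * X a' ω - ∫ ω', X a ω' * X a' ω' ∂P) *
      (X b ω * X b' ω * X n₀ ω * X n₁ ω * X n₂ ω * X n₃ ω)) P := integrable_wick2_mul_six hX _ _ _ _ _ _ _ _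
  have i2 : Integrable (fun ω => C b b' * (X a ω * X a' ω * X n₀ ω * X n₁ ω * X n₂ ω * X n₃ ω)) P :=
    (integrable_mul_six hX _ _ _ _ _ _).const_mul _
  have i3 : Integrable (fun ω => C b b' * C a a' * (X n₀ ω * X n₁ ω * X n₂ ω * X n₃ ω)) P :=
    (QuadCum3.integrable_mul_four hX _ _ _ _).const_mul _
  have i12 : Integrable (fun ω => (X a ω * X a' ω - ∫ ω', X a ω' * X a' ω' ∂P) *
      (X b ω * X b' ω * X n₀ ω * X n₁ ω * X n₂ ω * X n₃ ω) - C b b' * (X a ω * X a' ω * X n₀ ω * X n₁ ω * X n₂ ω * X n₃ ω)) P :=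
    i1.sub i2
  rw [integral_add i12 i3, integral_sub i1 i2, integral_const_mul, integral_const_mul, integral_wick2_mul_six hX h0,
    integral_prod_six hX h0]
  simp only [integral_prod_six hX h0, integral_mul_four hX h0, ← hC]
  ring

end WickPairCubic

open GaussianChartWick

/-! ## In the chart -/

section Chart

variable {ι : Type*} [Fintype ι] [DecidableEq ι]

/-- ★★ **Two centred pairs against a quartic monomial, connected part, in the chart** (`S = (2β)⁻¹P⁻¹` the covariance). -/
theorem gauss_wick2_wick2_mul_four_connected (P : Matrix ι ι ℝ) (hP : P.PosDef) {β : ℝ} (hβ : 0 < β) (S : ι → ι → ℝ)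
    (hS : ∀ i j, S i j = (2 * β)⁻¹ * P⁻¹ i j) (a a' b b' n₀ n₁ n₂ n₃ : ι) :
    (∫ v : ι → ℝ, (v a * v a' - S a a') * (v b * v b' - S b b') * (v n₀ * v n₁ * v n₂ * v n₃) * Real.exp (-(β * (v ⬝ᵥ P *ᵥ v)))) /
          (∫ v : ι → ℝ, Real.exp (-(β * (v ⬝ᵥ P *ᵥ v)))) -
        (S a b * S a' b' + S a b' * S a' b) *
          ((∫ v : ι → ℝ, v n₀ * v n₁ * v n₂ * v n₃ * Real.exp (-(β * (v ⬝ᵥ P *ᵥ v)))) / (∫ v : ι → ℝ, Real.exp (-(β * (v ⬝ᵥ P *ᵥ v))))) =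
      S a b * S a' n₀ * S b' n₁ * S n₂ n₃ +
        S a b * S a' n₀ * S b' n₂ * S n₁ n₃ +
        S a b * S a' n₀ * S b' n₃ * S n₁ n₂ +
        S a b * S a' n₁ * S b' n₀ * S n₂ n₃ +
        S a b * S a' n₁ * S b' n₂ * S n₀ n₃ +
        S a b * S a' n₁ * S b' n₃ * S n₀ n₂ +
        S a b * S a' n₂ * S b' n₀ * S n₁ n₃ +
        S a b * S a' n₂ * S b' n₁ * S n₀ n₃ +
        S a b * S a' n₂ * S b' n₃ * S n₀ n₁ +
        S a b * S a' n₃ * S b' n₀ * S n₁ n₂ +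
        S a b * S a' n₃ * S b' n₁ * S n₀ n₂ +
        S a b * S a' n₃ * S b' n₂ * S n₀ n₁ +
        S a b' * S a' n₀ * S b n₁ * S n₂ n₃ +
        S a b' * S a' n₀ * S b n₂ * S n₁ n₃ +
        S a b' * S a' n₀ * S b n₃ * S n₁ n₂ +
        S a b' * S a' n₁ * S b n₀ * S n₂ n₃ +
        S a b' * S a' n₁ * S b n₂ * S n₀ n₃ +
        S a b' * S a' n₁ * S b n₃ * S n₀ n₂ +
        S a b' * S a' n₂ * S b n₀ * S n₁ n₃ +
        S a b' * S a' n₂ * S b n₁ * S n₀ n₃ +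
        S a b' * S a' n₂ * S b n₃ * S n₀ n₁ +
        S a b' * S a' n₃ * S b n₀ * S n₁ n₂ +
        S a b' * S a' n₃ * S b n₁ * S n₀ n₂ +
        S a b' * S a' n₃ * S b n₂ * S n₀ n₁ +
        S a n₀ * S a' b * S b' n₁ * S n₂ n₃ +
        S a n₀ * S a' b * S b' n₂ * S n₁ n₃ +
        S a n₀ * S a' b * S b' n₃ * S n₁ n₂ +
        S a n₀ * S a' b' * S b n₁ * S n₂ n₃ +
        S a n₀ * S a' b' * S b n₂ * S n₁ n₃ +
        S a n₀ * S a' b' * S b n₃ * S n₁ n₂ +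
        S a n₀ * S a' n₁ * S b n₂ * S b' n₃ +
        S a n₀ * S a' n₁ * S b n₃ * S b' n₂ +
        S a n₀ * S a' n₂ * S b n₁ * S b' n₃ +
        S a n₀ * S a' n₂ * S b n₃ * S b' n₁ +
        S a n₀ * S a' n₃ * S b n₁ * S b' n₂ +
        S a n₀ * S a' n₃ * S b n₂ * S b' n₁ +
        S a n₁ * S a' b * S b' n₀ * S n₂ n₃ +
        S a n₁ * S a' b * S b' n₂ * S n₀ n₃ +
        S a n₁ * S a' b * S b' n₃ * S n₀ n₂ +
        S a n₁ * S a' b' * S b n₀ * S n₂ n₃ +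
        S a n₁ * S a' b' * S b n₂ * S n₀ n₃ +
        S a n₁ * S a' b' * S b n₃ * S n₀ n₂ +
        S a n₁ * S a' n₀ * S b n₂ * S b' n₃ +
        S a n₁ * S a' n₀ * S b n₃ * S b' n₂ +
        S a n₁ * S a' n₂ * S b n₀ * S b' n₃ +
        S a n₁ * S a' n₂ * S b n₃ * S b' n₀ +
        S a n₁ * S a' n₃ * S b n₀ * S b' n₂ +
        S a n₁ * S a' n₃ * S b n₂ * S b' n₀ +
        S a n₂ * S a' b * S b' n₀ * S n₁ n₃ +
        S a n₂ * S a' b * S b' n₁ * S n₀ n₃ +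
        S a n₂ * S a' b * S b' n₃ * S n₀ n₁ +
        S a n₂ * S a' b' * S b n₀ * S n₁ n₃ +
        S a n₂ * S a' b' * S b n₁ * S n₀ n₃ +
        S a n₂ * S a' b' * S b n₃ * S n₀ n₁ +
        S a n₂ * S a' n₀ * S b n₁ * S b' n₃ +
        S a n₂ * S a' n₀ * S b n₃ * S b' n₁ +
        S a n₂ * S a' n₁ * S b n₀ * S b' n₃ +
        S a n₂ * S a' n₁ * S b n₃ * S b' n₀ +
        S a n₂ * S a' n₃ * S b n₀ * S b' n₁ +
        S a n₂ * S a' n₃ * S b n₁ * S b' n₀ +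
        S a n₃ * S a' b * S b' n₀ * S n₁ n₂ +
        S a n₃ * S a' b * S b' n₁ * S n₀ n₂ +
        S a n₃ * S a' b * S b' n₂ * S n₀ n₁ +
        S a n₃ * S a' b' * S b n₀ * S n₁ n₂ +
        S a n₃ * S a' b' * S b n₁ * S n₀ n₂ +
        S a n₃ * S a' b' * S b n₂ * S n₀ n₁ +
        S a n₃ * S a' n₀ * S b n₁ * S b' n₂ +
        S a n₃ * S a' n₀ * S b n₂ * S b' n₁ +
        S a n₃ * S a' n₁ * S b n₀ * S b' n₂ +
        S a n₃ * S a' n₁ * S b n₂ * S b' n₀ +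
        S a n₃ * S a' n₂ * S b n₀ * S b' n₁ +
        S a n₃ * S a' n₂ * S b n₁ * S b' n₀ := by
  obtain ⟨R, hRP, hR, htr⟩ := integral_mul_exp_quadForm_eq_integral_legs P hP hβ
  set e := Fintype.equivFin ι with he
  set μ : Measure (Fin (Fintype.card ι) → ℝ) :=
    Measure.pi (fun _ : Fin (Fintype.card ι) => gaussianReal 0 (Real.toNNReal (2 * β)⁻¹)) with hμ
  set Z : ℝ := Real.sqrt (Real.pi / β) ^ Fintype.card ι / |R.det| with hZ
  have hZpos : 0 < Z := div_pos (pow_pos (Real.sqrt_pos.mpr (div_pos Real.pi_pos hβ)) _) (abs_pos.mpr hR)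
  set X : (Fin (Fintype.card ι) → ℝ) → (Fin (Fintype.card ι) → ℝ) → ℝ := fun ℓ u => ℓ ⬝ᵥ (R⁻¹ *ᵥ u) with hX
  have hGP : IsGaussianProcess X μ := isGaussianProcess_legs R β
  have h0 : ∀ ℓ, ∫ u, X ℓ u ∂μ = 0 := integral_leg_eq_zero R β
  set t : ι → (Fin (Fintype.card ι) → ℝ) := fun i => Pi.single (e i) (1 : ℝ) with ht
  set φ : (Fin (Fintype.card ι) → ℝ) → (ι → ℝ) := fun u i => (R⁻¹ *ᵥ u) (e i) with hφ
  have hXt : ∀ i u, X (t i) u = φ u i := fun i u => by simp only [hX, ht, hφ, single_one_dotProduct]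
  set C : (Fin (Fintype.card ι) → ℝ) → (Fin (Fintype.card ι) → ℝ) → ℝ := fun s s' => ∫ u, X s u * X s' u ∂μ with hC
  have hCS : ∀ i j, C (t i) (t j) = S i j := fun i j => by rw [hS]; exact two_point_legs P hβ hRP i j
  have hnorm : ∫ v : ι → ℝ, Real.exp (-(β * (v ⬝ᵥ P *ᵥ v))) = Z := by
    have h := htr (fun _ => 1)
    simp only [one_mul] at h
    rw [h, integral_const, smul_eq_mul, probReal_univ, one_mul, mul_one]
  have hE : ∀ F : (ι → ℝ) → ℝ, (∫ v : ι → ℝ, F v * Real.exp (-(β * (v ⬝ᵥ P *ᵥ v)))) /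
      (∫ v : ι → ℝ, Real.exp (-(β * (v ⬝ᵥ P *ᵥ v)))) = ∫ u, F (φ u) ∂μ := fun F => by
    rw [hnorm, htr F, mul_div_cancel_left₀ _ hZpos.ne']
  rw [hE (fun v => (v a * v a' - S a a') * (v b * v b' - S b b') * (v n₀ * v n₁ * v n₂ * v n₃)), hE (fun v => v n₀ * v n₁ * v n₂ * v n₃)]
  have key := WickPairCubic.integral_wick2_wick2_mul_four_connected hGP h0 C (fun _ _ => rfl) (t a) (t a') (t b) (t b') (t n₀) (t n₁) (t n₂) (t n₃)
  simp only [hXt, hCS] at key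
  rw [← key]

end Chart

end Summit.QuantumFields.YangMills.Theorems.AllWindowsColdBoxBoxHighLine

end
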